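import Literature.NumberTheory.LFunctions.ZeroDensityInghamTools
import Literature.NumberTheory.LFunctions.ZetaFourthMomentWeak
import Literature.NumberTheory.LFunctions.NymanBeurlingDirichlet
import Literature.NumberTheory.LFunctions.ApproxFunctionalEquation
import Literature.NumberTheory.Sieve.DivisorBound
import HarnessLib

/-!
# Ingham's zero-density estimate `A(σ) ≤ 3/(2-σ)` from the fourth moment of `ζ`

Trunk T-ANT, topic `Literature/NumberTheory/LFunctions`. This file PROVES the named fact
`Literature.NumberTheory.LFunctions.zeroDensity_ingham` (`zeroDensity_ingham_holds`), through

  `Literature.zeroDensity_ingham_of_fourthMoment :`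
    `Literature.zetaFourthMomentWeak → Literature.zeroDensity_ingham`,

i.e. the named fact `Literature.NumberTheory.LFunctions.zeroDensity_ingham` of `ZeroCounting.lean`
(`N(σ, T) ≪_ε T^{3(1-σ)/(2-σ)+ε}` for `1/2 ≤ σ ≤ 1`; Ingham 1940; Titchmarsh Thm 9.19(B) for the
full range; cf. Ivić Thm 11.1 (11.22), printed for `1/2 ≤ σ ≤ 3/4` only — Ivić's argument, followed
here, is uniform in `1/2 < σ < 1`) from the weak fourth power moment
`∫_0^T |ζ(1/2+it)|⁴ dt ≪_ε T^{1+ε}` (`Literature.NumberTheory.LFunctions.zetaFourthMomentWeak`, the `T^ε`-weakening of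
Titchmarsh (7.6.1), proved in `ZetaFourthMomentWeak.lean` from the approximate functional equation
in the form `Literature.NumberTheory.LFunctions.Bourgain2017_eq43`; hence also `zeroDensity_ingham_of_eq43`).

The argument is Ivić's (§11.2–§11.3) with `X = T`, `Y = T^{3/(4-2σ)}` and the Riesz kernel in place
of `Γ` (`ZetaZeroDetection.lean`): for a zero `ρ = β+iγ`, `β ≥ σ`, `U < γ ≤ 2U`, the dichotomy
`zeroDetection_norm_ineq` gives (`perZero_dichotomy`) either the Class-I condition
`|∑_{X<n≤X2^J} b(n) n^{-ρ}| ≥ 1/8`, `b(n) = a_X(n)(1-n/Y)₊²`, or — after truncating the line integral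
to `|y| ≤ U` (`classTwo_truncate`, tail `≤ 64π` from `|K(c+iy)| ≤ 2/|y|³`, `|ζ(1/2+it)| ≤ 4(1+|t|)`,
`|M_X| ≤ X`) — the Class-II condition `∫_{-U}^{U} |K||ζ||M_X| ≥ (π/4) Y^{σ-1/2}`; the residue term
`Y^{1-β}|K(1-ρ)|(1+log X) ≤ 2√Y(1+log X)/U³` is negligible. Class I is counted by
`ZeroDensity.classOne_count` (dyadic blocks, the discrete mean value theorem, `d(n) ≪ n^η`),
Class II by `ZeroDensity.classTwo_core` with the fourth moment and the mean square of the
mollifier (`meanSquare_mollifier_le`, from the weak mean value theorem); with the exponent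
identities `a(2-2σ) = κ₀`, `3 - 4a(σ-1/2) = 3κ₀` (`a = 3/(4-2σ)`, `κ₀ = 3(1-σ)/(2-σ)`) both classes
are `≪ (1+log U)⁴ U^{κ₀+3η}` (`wellSpaced_of_fourthMoment`). The counting layer of
`ZeroDensityInghamTools.lean` turns this into `N(σ, T) = O(T^{κ₀+5η})`, and `η = ε/5` gives the
claim; `σ = 1/2` is the trivial bound `Literature.NumberTheory.LFunctions.zeroDensity_trivial` and `σ = 1` is `N(1, T) = 0`.

## Main statements

* `Literature.NumberTheory.LFunctions.zetaFourthMomentWeak` (`ZetaFourthMomentWeak.lean`) — the hypothesis, Titchmarsh (7.6.1)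
  weakened to `T^{1+ε}`, itself proved there from `Literature.NumberTheory.LFunctions.Bourgain2017_eq43`.
* `Literature.NumberTheory.LFunctions.ZeroDensity.perZero_dichotomy`, `classOne_final`, `classTwo_final`,
  `wellSpaced_of_fourthMoment`, `wellSpacedBound_of_eventually`.
* `Literature.NumberTheory.LFunctions.zeroDensity_ingham_of_fourthMoment`, `Literature.NumberTheory.LFunctions.zeroDensity_ingham_of_eq43`, and the discharge
  `Literature.zeroDensity_ingham_holds : Literature.zeroDensity_ingham` (via `Literature.NumberTheory.LFunctions.Bourgain2017_eq43_holds`).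

## References

* A. Ivić, *The Riemann Zeta-Function*, Wiley 1985, §11.2 (11.4)–(11.12), §11.3 Thm 11.1 (11.22).
* E. C. Titchmarsh, *The Theory of the Riemann Zeta-Function*, 2nd ed. (1986), Thm 9.19(B), §7.6
  (7.6.1), §2.12 (2.12.2).
* A. E. Ingham, *On the estimation of `N(σ, T)`*, Quart. J. Math. 11 (1940), 291–292.
-/

noncomputable section

open Finset Real Complex MeasureTheory intervalIntegral Filter Asymptotics

namespace Literature.NumberTheory.LFunctions

namespace ZeroDensity


/-! ### Crude bounds -/

/-- `‖ζ(1/2 + it)‖ ≤ 4(1 + |t|)` (from Titchmarsh (2.12.2)). [cite: Titchmarsh1986, §2.12 eq. (2.12.2)] -/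
theorem norm_zeta_half_line_le (t : ℝ) : ‖riemannZeta (1 / 2 + t * I)‖ ≤ 4 * (1 + |t|) := by
  set s : ℂ := 1 / 2 + t * I with hs
  have hre : s.re = 1 / 2 := by simp [hs]
  have him : s.im = t := by simp [hs]
  have hs1 : s ≠ 1 := fun h ↦ by have := congrArg Complex.re h; rw [hre] at this; norm_num at this
  have h := Literature.NumberTheory.LFunctions.norm_riemannZeta_le_of_re_pos (s := s) (by rw [hre]; norm_num) hs1
  have hns : ‖s‖ ≤ 1 / 2 + |t| := by
    calc ‖s‖ ≤ |s.re| + |s.im| := Complex.norm_le_abs_re_add_abs_im s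
      _ = 1 / 2 + |t| := by rw [hre, him]; norm_num
  have hs1n : 1 / 2 ≤ ‖s - 1‖ := by
    have := Complex.abs_re_le_norm (s - 1)
    rw [sub_re, hre, one_re] at this
    norm_num at this
    linarith
  rw [hre] at h
  have h1 : ‖s‖ / ‖s - 1‖ ≤ 2 * ‖s‖ := by
    rw [div_le_iff₀ (by linarith)]; nlinarith [norm_nonneg s]
  have h2 : ‖s‖ / (1 / 2) = 2 * ‖s‖ := by ring
  rw [h2] at h
  linarith

/-- `‖K(c + iy)‖ ≤ 2/|y|³` for real `c` and `y ≠ 0` (each factor of `w(w+1)(w+2)` has modulus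
`≥ |y|`). [folklore] -/
theorem norm_rieszK_le_two_div_cube (c : ℝ) {y : ℝ} (hy : y ≠ 0) :
    ‖ZeroDetect.rieszK ((c : ℂ) + y * I)‖ ≤ 2 / |y| ^ 3 := by
  set z : ℂ := (c : ℂ) + y * I with hz
  have him : ∀ j : ℝ, (z + j).im = y := fun j ↦ by simp [hz]
  have hge : ∀ j : ℝ, |y| ≤ ‖z + j‖ := fun j ↦ by
    have := Complex.abs_im_le_norm (z + j); rwa [him] at this
  have hy0 : 0 < |y| := abs_pos.2 hy
  have hne : ∀ j : ℝ, z + j ≠ 0 := fun j h ↦ by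
    have := hge j; rw [h, norm_zero] at this; linarith
  have h0 : z ≠ 0 := by simpa using hne 0
  have h1 : z + 1 ≠ 0 := by exact_mod_cast hne 1
  have h2 : z + 2 ≠ 0 := by exact_mod_cast hne 2
  rw [ZeroDetect.rieszK, Literature.NumberTheory.LFunctions.RieszPerron.Kfun_eq h0 h1 h2, norm_div, norm_mul, norm_mul,
    Complex.norm_two]
  have hz0 : |y| ≤ ‖z‖ := by simpa using hge 0
  have hz1 : |y| ≤ ‖z + 1‖ := by exact_mod_cast hge 1
  have hz2 : |y| ≤ ‖z + 2‖ := by exact_mod_cast hge 2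
  have hprod : |y| ^ 3 ≤ ‖z‖ * ‖z + 1‖ * ‖z + 2‖ := by
    calc |y| ^ 3 = |y| * |y| * |y| := by ring
      _ ≤ ‖z‖ * ‖z + 1‖ * ‖z + 2‖ :=
          mul_le_mul (mul_le_mul hz0 hz1 hy0.le (norm_nonneg _)) hz2 hy0.le (by positivity)
  exact div_le_div_of_nonneg_left (by norm_num) (by positivity) hprod

/-- `‖K(1 - ρ)‖ ≤ 2/γ³` for `γ = Im ρ > 0`. [folklore] -/
theorem norm_rieszK_one_sub_le {ρ : ℂ} (hγ : 0 < ρ.im) :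
    ‖ZeroDetect.rieszK (1 - ρ)‖ ≤ 2 / ρ.im ^ 3 := by
  have e : (1 - ρ : ℂ) = (((1 - ρ.re : ℝ)) : ℂ) + ((-ρ.im : ℝ) : ℂ) * I := by
    apply Complex.ext <;> simp
  rw [e]
  have h := norm_rieszK_le_two_div_cube (1 - ρ.re) (y := -ρ.im) (by linarith)
  rwa [abs_neg, abs_of_pos hγ] at h

/-- `∫_ℝ dy/(T² + y²) = π/T` (`T > 0`). [folklore] -/
theorem integral_inv_sq_add_sq_real {T : ℝ} (hT : 0 < T) :
    ∫ y : ℝ, (T ^ 2 + y ^ 2)⁻¹ = π / T := by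
  have e : (fun y : ℝ ↦ (T ^ 2 + y ^ 2)⁻¹) = fun y : ℝ ↦ (T ^ 2)⁻¹ * (1 + (y / T) ^ 2)⁻¹ := by
    funext y
    have hT2 : T ^ 2 ≠ 0 := by positivity
    field_simp
  rw [e, MeasureTheory.integral_const_mul,
    MeasureTheory.Measure.integral_comp_div (fun y : ℝ ↦ (1 + y ^ 2)⁻¹) T,
    integral_univ_inv_one_add_sq, abs_of_pos hT, smul_eq_mul]
  field_simp

/-- **Truncation of the Class-II integral.** For `T ≥ 1`, `1 ≤ X ≤ T`, `T ≤ γ ≤ 2T` and any real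
`c`: if `A ≤ ∫_ℝ |K(c+iy)| |ζ(1/2+i(γ+y))| |M_X(1/2+i(γ+y))| dy` with `A > 0`, then
`A - 64π ≤ ∫_{-T}^{T} (same)`; the tail is bounded using `|K(c+iy)| ≤ 2/|y|³`,
`|ζ(1/2+it)| ≤ 4(1+|t|)`, `|M_X| ≤ X ≤ T`, by `∫_ℝ 64T/(T²+y²) dy = 64π`. [folklore] -/
theorem classTwo_truncate {X : ℕ} {T γ c A : ℝ} (hT : 1 ≤ T) (hXT : (X : ℝ) ≤ T)
    (hγ1 : T ≤ γ) (hγ2 : γ ≤ 2 * T) (hA0 : 0 < A)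
    (hA : A ≤ ∫ y : ℝ, ‖ZeroDetect.rieszK ((c : ℂ) + y * I)‖ *
      (‖riemannZeta (1 / 2 + (γ + y) * I)‖ * ‖ZeroDetect.mollifier X (1 / 2 + (γ + y) * I)‖)) :
    A - 64 * π ≤ ∫ y in (-T)..T, ‖ZeroDetect.rieszK ((c : ℂ) + y * I)‖ *
      (‖riemannZeta (1 / 2 + (γ + y) * I)‖ * ‖ZeroDetect.mollifier X (1 / 2 + (γ + y) * I)‖) := by
  set f : ℝ → ℝ := fun y ↦ ‖ZeroDetect.rieszK ((c : ℂ) + y * I)‖ *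
      (‖riemannZeta (1 / 2 + (γ + y) * I)‖ * ‖ZeroDetect.mollifier X (1 / 2 + (γ + y) * I)‖) with hf
  have hf0 : ∀ y, 0 ≤ f y := fun y ↦ by positivity
  -- integrability is forced by `A > 0`
  have hint : Integrable f := by
    by_contra h
    rw [integral_undef h] at hA
    linarith
  have hT0 : 0 < T := by linarith
  set s : Set ℝ := Set.Icc (-T) T with hs
  have hsm : MeasurableSet s := measurableSet_Icc
  have hsplit : ∫ y, f y = (∫ y in s, f y) + ∫ y in sᶜ, f y := (integral_add_compl hsm hint).symm
  have hIcc : ∫ y in s, f y = ∫ y in (-T)..T, f y := by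
    rw [intervalIntegral.integral_of_le (by linarith), hs, integral_Icc_eq_integral_Ioc]
  -- the majorant on the tail
  set g : ℝ → ℝ := fun y ↦ 64 * T * (T ^ 2 + y ^ 2)⁻¹ with hg
  have hgint : Integrable g := (Literature.NumberTheory.LFunctions.RieszPerron.integrable_inv_sq_add_sq hT0.ne').const_mul _
  have hg0 : ∀ y, 0 ≤ g y := fun y ↦ by positivity
  have hfg : ∀ y ∈ sᶜ, f y ≤ g y := by
    intro y hy
    have hyT : T < |y| := by
      simp only [hs, Set.mem_compl_iff, Set.mem_Icc, not_and_or, not_le] at hy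
      rcases hy with hy | hy
      · rw [abs_of_neg (by linarith)]; linarith
      · rw [abs_of_pos (by linarith)]; exact hy
    have hy0 : y ≠ 0 := fun h ↦ by rw [h, abs_zero] at hyT; linarith
    have hyp : 0 < |y| := abs_pos.2 hy0
    have hK := norm_rieszK_le_two_div_cube c hy0
    have hζ : ‖riemannZeta (1 / 2 + ((γ : ℂ) + y) * I)‖ ≤ 4 * (1 + |γ + y|) := by
      have := norm_zeta_half_line_le (γ + y); push_cast at this; exact this
    have hM : ‖ZeroDetect.mollifier X (1 / 2 + (γ + y) * I)‖ ≤ T :=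
      (ZeroDetect.norm_mollifier_le (by simp)).trans hXT
    have hγy : |γ + y| ≤ 2 * T + |y| := (abs_add_le _ _).trans (by rw [abs_of_nonneg (by linarith)]; linarith)
    have h1 : f y ≤ 2 / |y| ^ 3 * (4 * (1 + 2 * T + |y|) * T) := by
      simp only [hf]
      refine mul_le_mul hK ?_ (by positivity) (by positivity)
      calc ‖riemannZeta (1 / 2 + (γ + y) * I)‖ * ‖ZeroDetect.mollifier X (1 / 2 + (γ + y) * I)‖
          ≤ 4 * (1 + |γ + y|) * T := mul_le_mul hζ hM (norm_nonneg _) (by positivity)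
        _ ≤ 4 * (1 + 2 * T + |y|) * T := by
            have : 1 + |γ + y| ≤ 1 + 2 * T + |y| := by linarith
            gcongr
    refine h1.trans ?_
    -- `8T(1+2T+|y|)/|y|³ ≤ 64T/(T²+y²)`
    simp only [hg]
    have hu1 : 1 + 2 * T + |y| ≤ 4 * |y| := by linarith
    have hu2 : T ^ 2 + y ^ 2 ≤ 2 * |y| ^ 2 := by
      have h := pow_lt_pow_left₀ hyT (by linarith) (two_ne_zero)
      rw [sq_abs] at h ⊢
      linarith
    have hpos : 0 < T ^ 2 + y ^ 2 := by positivity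
    rw [div_mul_eq_mul_div, div_le_iff₀ (by positivity)]
    rw [show 64 * T * (T ^ 2 + y ^ 2)⁻¹ * |y| ^ 3 = (64 * T * |y| ^ 3) / (T ^ 2 + y ^ 2) by ring,
      le_div_iff₀ hpos]
    calc 2 * (4 * (1 + 2 * T + |y|) * T) * (T ^ 2 + y ^ 2)
        ≤ 2 * (4 * (4 * |y|) * T) * (2 * |y| ^ 2) := by gcongr
      _ = 64 * T * |y| ^ 3 := by ring
  have htail : ∫ y in sᶜ, f y ≤ 64 * π := by
    calc ∫ y in sᶜ, f y ≤ ∫ y in sᶜ, g y :=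
          setIntegral_mono_on hint.integrableOn hgint.integrableOn hsm.compl hfg
      _ ≤ ∫ y, g y := setIntegral_le_integral hgint (Eventually.of_forall hg0)
      _ = 64 * π := by
          simp only [hg]
          rw [MeasureTheory.integral_const_mul, integral_inv_sq_add_sq_real hT0]
          field_simp
  rw [hsplit, hIcc] at hA
  linarith

/-! ### The Class-I coefficients `b(n) = a_X(n) (1 - n/Y)₊²` -/

/-- The Class-I coefficients `b(n) = a_X(n) (1 - n/Y)₊²` (Ivić (11.9), Riesz weights). [cite: Ivic1985, §11.2 (11.9)] -/
def coeffB (X Y : ℕ) (n : ℕ) : ℂ :=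
  ZeroDetect.mollCoeff X n * ((((max (1 - (n : ℝ) / Y) 0) ^ 2 : ℝ)) : ℂ)

/-- `|b(n)| ≤ d(n)`. [folklore] -/
theorem norm_coeffB_le (X Y n : ℕ) : ‖coeffB X Y n‖ ≤ (n.divisors.card : ℝ) := by
  rw [coeffB, norm_mul, Complex.norm_real, Real.norm_of_nonneg (sq_nonneg _)]
  have h1 : (max (1 - (n : ℝ) / Y) 0) ^ 2 ≤ 1 := by
    have hm0 : 0 ≤ max (1 - (n : ℝ) / Y) 0 := le_max_right _ _
    have hm1 : max (1 - (n : ℝ) / Y) 0 ≤ 1 := max_le (by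
      have : 0 ≤ (n : ℝ) / Y := by positivity
      linarith) zero_le_one
    nlinarith
  calc ‖ZeroDetect.mollCoeff X n‖ * (max (1 - (n : ℝ) / Y) 0) ^ 2
      ≤ (n.divisors.card : ℝ) * 1 :=
        mul_le_mul (ZeroDetect.norm_mollCoeff_le X n) h1 (sq_nonneg _) (Nat.cast_nonneg _)
    _ = _ := mul_one _

/-- `b(n) = 0` for `n ≥ Y`. [folklore] -/
theorem coeffB_eq_zero_of_le {X Y n : ℕ} (hY : 0 < Y) (h : Y ≤ n) : coeffB X Y n = 0 := by
  rw [coeffB]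
  have : max (1 - (n : ℝ) / Y) 0 = 0 := max_eq_right (by
    rw [sub_nonpos, le_div_iff₀ (by exact_mod_cast hY), one_mul]; exact_mod_cast h)
  rw [this]; simp

/-- For `n ≤ Y`: `b(n) = a_X(n)(1 - n/Y)²`. [folklore] -/
theorem coeffB_eq_of_le {X Y n : ℕ} (h : n ≤ Y) (hY : 0 < Y) :
    coeffB X Y n = ZeroDetect.mollCoeff X n * ((((1 : ℝ) - (n : ℝ) / Y) ^ 2 : ℝ) : ℂ) := by
  rw [coeffB]
  have : max (1 - (n : ℝ) / Y) 0 = 1 - (n : ℝ) / Y := max_eq_left (by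
    rw [sub_nonneg, div_le_iff₀ (by exact_mod_cast hY), one_mul]; exact_mod_cast h)
  rw [this]

/-- The F1a tail sum equals the `b`-sum over `(X, X·2^J]` once `X·2^J ≥ Y`. [folklore] -/
theorem sum_Ioc_eq_sum_coeffB {X Y J : ℕ} (hY : 0 < Y) (hJ : Y ≤ X * 2 ^ J) (ρ : ℂ) :
    ∑ n ∈ Finset.Ioc X Y, ZeroDetect.mollCoeff X n *
        ((((1 : ℝ) - (n : ℝ) / Y) ^ 2 : ℝ) : ℂ) * (n : ℂ) ^ (-ρ) =
      ∑ n ∈ Finset.Ioc X (X * 2 ^ J), coeffB X Y n * (n : ℂ) ^ (-ρ) := by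
  rcases le_or_gt X Y with hXY | hXY
  · have hsub : Finset.Ioc X Y ⊆ Finset.Ioc X (X * 2 ^ J) := fun n hn ↦ by
      simp only [Finset.mem_Ioc] at hn ⊢; exact ⟨hn.1, hn.2.trans hJ⟩
    rw [← Finset.sum_subset hsub]
    · refine Finset.sum_congr rfl fun n hn ↦ ?_
      simp only [Finset.mem_Ioc] at hn
      rw [coeffB_eq_of_le hn.2 hY]
    · intro n hn hn'
      simp only [Finset.mem_Ioc, not_and, not_le] at hn hn'
      rw [coeffB_eq_zero_of_le hY (hn' hn.1).le, zero_mul]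
  · -- `Y < X`: both sums vanish
    have h1 : Finset.Ioc X Y = ∅ := by ext n; simp; omega
    rw [h1, Finset.sum_empty]
    symm
    refine Finset.sum_eq_zero fun n hn ↦ ?_
    simp only [Finset.mem_Ioc] at hn
    rw [coeffB_eq_zero_of_le hY (by omega), zero_mul]

/-- Dyadic decomposition of `(X, X·2^J]`. [folklore] -/
theorem sum_Ioc_mul_two_pow (f : ℕ → ℂ) (X J : ℕ) :
    ∑ n ∈ Finset.Ioc X (X * 2 ^ J), f n =
      ∑ i ∈ Finset.range J, ∑ n ∈ Finset.Ioc (X * 2 ^ i) (X * 2 ^ (i + 1)), f n := by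
  induction J with
  | zero => simp
  | succ J ih =>
    rw [Finset.sum_range_succ, ← ih]
    have hle : X * 2 ^ J ≤ X * 2 ^ (J + 1) := Nat.mul_le_mul_left X (Nat.pow_le_pow_right (by norm_num) (by omega))
    have hle0 : X ≤ X * 2 ^ J := Nat.le_mul_of_pos_right X (by positivity)
    rw [← Finset.sum_union (Finset.Ioc_disjoint_Ioc_of_le le_rfl)]
    congr 1
    ext n; simp only [Finset.mem_Ioc, Finset.mem_union]; omega

/-- `X·2^{i+1} = 2 (X 2^i)`. [folklore] -/
theorem mul_two_pow_succ (X i : ℕ) : X * 2 ^ (i + 1) = 2 * (X * 2 ^ i) := by ring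

/-- **The coefficient sum of a block**: for `η > 0` with the divisor bound `d(n) ≤ C_d n^η` and
`1 + 2η - 2σ ≤ 0`, `∑_{M<n≤2M} |b(n)|² n^{-2σ} ≤ C_d² M^{1+2η-2σ}` (`M ≥ 1`). [folklore] -/
theorem sum_norm_coeffB_sq_le {C_d η σ : ℝ} (hd : ∀ n : ℕ, (n.divisors.card : ℝ) ≤ C_d * (n : ℝ) ^ η)
    (hexp : 1 + 2 * η - 2 * σ ≤ 0) (X Y : ℕ) {M : ℕ} (hM : 1 ≤ M) :
    ∑ n ∈ Finset.Ioc M (2 * M), ‖coeffB X Y n‖ ^ 2 * (n : ℝ) ^ (-2 * σ) ≤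
      C_d ^ 2 * (M : ℝ) ^ (1 + 2 * η - 2 * σ) := by
  have hM0 : (0 : ℝ) < M := by exact_mod_cast hM
  have hterm : ∀ n ∈ Finset.Ioc M (2 * M), ‖coeffB X Y n‖ ^ 2 * (n : ℝ) ^ (-2 * σ) ≤
      C_d ^ 2 * (M : ℝ) ^ (2 * η - 2 * σ) := by
    intro n hn
    simp only [Finset.mem_Ioc] at hn
    have hn0 : (0 : ℝ) < n := by exact_mod_cast (by omega : 0 < n)
    have hMn : (M : ℝ) ≤ n := by exact_mod_cast hn.1.le
    have h1 : ‖coeffB X Y n‖ ≤ C_d * (n : ℝ) ^ η := (norm_coeffB_le X Y n).trans (hd n)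
    have h2 : ‖coeffB X Y n‖ ^ 2 ≤ C_d ^ 2 * (n : ℝ) ^ (2 * η) := by
      calc ‖coeffB X Y n‖ ^ 2 ≤ (C_d * (n : ℝ) ^ η) ^ 2 := pow_le_pow_left₀ (norm_nonneg _) h1 2
        _ = C_d ^ 2 * (n : ℝ) ^ (2 * η) := by
            rw [mul_pow, ← Real.rpow_natCast ((n : ℝ) ^ η), ← Real.rpow_mul hn0.le]
            congr 2
            push_cast
            ring
    calc ‖coeffB X Y n‖ ^ 2 * (n : ℝ) ^ (-2 * σ)
        ≤ C_d ^ 2 * (n : ℝ) ^ (2 * η) * (n : ℝ) ^ (-2 * σ) :=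
          mul_le_mul_of_nonneg_right h2 (Real.rpow_nonneg hn0.le _)
      _ = C_d ^ 2 * (n : ℝ) ^ (2 * η - 2 * σ) := by
          rw [mul_assoc, ← Real.rpow_add hn0]; ring_nf
      _ ≤ C_d ^ 2 * (M : ℝ) ^ (2 * η - 2 * σ) :=
          mul_le_mul_of_nonneg_left (Real.rpow_le_rpow_of_nonpos hM0 hMn (by linarith)) (sq_nonneg _)
  calc ∑ n ∈ Finset.Ioc M (2 * M), ‖coeffB X Y n‖ ^ 2 * (n : ℝ) ^ (-2 * σ)
      ≤ ∑ n ∈ Finset.Ioc M (2 * M), C_d ^ 2 * (M : ℝ) ^ (2 * η - 2 * σ) := Finset.sum_le_sum hterm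
    _ = M * (C_d ^ 2 * (M : ℝ) ^ (2 * η - 2 * σ)) := by
        rw [Finset.sum_const, nsmul_eq_mul, Nat.card_Ioc]
        congr 1
        rw [show 2 * M - M = M by omega]
    _ = C_d ^ 2 * (M : ℝ) ^ (1 + 2 * η - 2 * σ) := by
        rw [show (1 : ℝ) + 2 * η - 2 * σ = 1 + (2 * η - 2 * σ) by ring, Real.rpow_add hM0,
          Real.rpow_one]
        ring

/-- The property of the absolute constant of the Class-I count (`exists_classOne_const`). [folklore] -/
def IsClassOneConst (C₀ : ℝ) : Prop :=
  ∀ (b : ℕ → ℂ) (M : ℕ) (σ T V : ℝ) (Z : Finset ℂ), 1 ≤ M → 1 ≤ T → 0 < V →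
    (∀ ρ ∈ Z, σ ≤ ρ.re ∧ ρ.re ≤ σ + 1 / 2) → (∀ ρ ∈ Z, |ρ.im| ≤ T) →
    (∀ ρ ∈ Z, ∀ ρ' ∈ Z, ρ ≠ ρ' → 1 ≤ |ρ.im - ρ'.im|) →
    (∀ ρ ∈ Z, V ≤ ‖∑ n ∈ Finset.Ioc M (2 * M), b n * (n : ℂ) ^ (-ρ)‖) →
    (Z.card : ℝ) ≤ C₀ * (T + 2 * M) * Real.log (4 * M) *
      (∑ n ∈ Finset.Ioc M (2 * M), ‖b n‖ ^ 2 * (n : ℝ) ^ (-2 * σ)) / V ^ 2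

/-- There is an absolute Class-I constant. [cite: Ivic1985, §11.3 proof of (11.22), bound for R₁] -/
theorem exists_isClassOneConst : ∃ C₀ : ℝ, 0 ≤ C₀ ∧ IsClassOneConst C₀ := exists_classOne_const

/-- **The Class-I count for the zero-detecting polynomial** (Ivić §11.3, `R₁` in the proof of
(11.22)): dyadic blocks `(X2^i, X2^{i+1}]`, `i < J`, all of length `< Y`; pigeonhole over the
blocks; the block count `IsClassOneConst`; and the coefficient bound `sum_norm_coeffB_sq_le`.
[cite: Ivic1985, §11.3 proof of (11.22), bound for R₁] -/
theorem classOne_count {C₀ : ℝ} (hC₀ : 0 ≤ C₀) (hC : IsClassOneConst C₀)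
    {C_d η σ : ℝ} (hd : ∀ n : ℕ, (n.divisors.card : ℝ) ≤ C_d * (n : ℝ) ^ η)
    (he₁ : 1 + 2 * η - 2 * σ ≤ 0) (he₂ : 0 ≤ 2 + 2 * η - 2 * σ)
    {X Y J : ℕ} (hX : 1 ≤ X) (hY : 1 ≤ Y) (hJ : ∀ i < J, X * 2 ^ i < Y) {U : ℝ} (hU : 1 ≤ U)
    (Z : Finset ℂ) (hZ : ∀ ρ ∈ Z, σ ≤ ρ.re ∧ ρ.re ≤ σ + 1 / 2 ∧ |ρ.im| ≤ 2 * U)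
    (hsep : ∀ ρ ∈ Z, ∀ ρ' ∈ Z, ρ ≠ ρ' → 1 ≤ |ρ.im - ρ'.im|)
    (hlarge : ∀ ρ ∈ Z, 1 / 8 ≤ ‖∑ n ∈ Finset.Ioc X (X * 2 ^ J), coeffB X Y n * (n : ℂ) ^ (-ρ)‖) :
    (Z.card : ℝ) ≤ 128 * J ^ 3 * C₀ * C_d ^ 2 * Real.log (4 * Y) *
      (U * (X : ℝ) ^ (1 + 2 * η - 2 * σ) + (Y : ℝ) ^ (2 + 2 * η - 2 * σ)) := by
  classical
  -- notation for the blocks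
  set S : ℕ → ℂ → ℂ := fun i ρ ↦ ∑ n ∈ Finset.Ioc (X * 2 ^ i) (X * 2 ^ (i + 1)),
    coeffB X Y n * (n : ℂ) ^ (-ρ) with hS
  have hsplit : ∀ ρ, ∑ n ∈ Finset.Ioc X (X * 2 ^ J), coeffB X Y n * (n : ℂ) ^ (-ρ) =
      ∑ i ∈ Finset.range J, S i ρ := fun ρ ↦ sum_Ioc_mul_two_pow _ X J
  -- the case `J = 0` is vacuous
  rcases Nat.eq_zero_or_pos J with hJ0 | hJpos
  · subst hJ0
    have : Z = ∅ := by
      rw [Finset.eq_empty_iff_forall_notMem]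
      intro ρ hρ
      have h := hlarge ρ hρ
      rw [hsplit ρ] at h
      simp at h
      linarith
    rw [this]; simp
  have hJr : (1 : ℝ) ≤ J := by exact_mod_cast hJpos
  -- pigeonhole: each `ρ ∈ Z` has a block `i < J` with `‖S i ρ‖ ≥ 1/(8J)`
  set V : ℝ := 1 / (8 * J) with hV
  have hV0 : 0 < V := by positivity
  have hpig : ∀ ρ ∈ Z, ∃ i ∈ Finset.range J, V ≤ ‖S i ρ‖ := by
    intro ρ hρ
    by_contra hcon
    push Not at hcon
    have h1 := hlarge ρ hρ
    rw [hsplit ρ] at h1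
    have h2 : ‖∑ i ∈ Finset.range J, S i ρ‖ < 1 / 8 := by
      calc ‖∑ i ∈ Finset.range J, S i ρ‖ ≤ ∑ i ∈ Finset.range J, ‖S i ρ‖ := norm_sum_le _ _
        _ < ∑ i ∈ Finset.range J, V := Finset.sum_lt_sum_of_nonempty ⟨0, by simp; omega⟩ hcon
        _ = J * V := by simp
        _ = 1 / 8 := by rw [hV]; field_simp
    linarith
  have hcover : Z ⊆ (Finset.range J).biUnion (fun i ↦ Z.filter (fun ρ ↦ V ≤ ‖S i ρ‖)) := by
    intro ρ hρ
    rw [Finset.mem_biUnion]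
    obtain ⟨i, hi, hVi⟩ := hpig ρ hρ
    exact ⟨i, hi, Finset.mem_filter.2 ⟨hρ, hVi⟩⟩
  -- the per-block count
  have hlogY0 : 0 ≤ Real.log (4 * (Y : ℝ)) := Real.log_nonneg (by
    have : (1 : ℝ) ≤ Y := by exact_mod_cast hY
    linarith)
  have hblock : ∀ i ∈ Finset.range J, ((Z.filter (fun ρ ↦ V ≤ ‖S i ρ‖)).card : ℝ) ≤
      128 * J ^ 2 * C₀ * C_d ^ 2 * Real.log (4 * Y) *
        (U * (X : ℝ) ^ (1 + 2 * η - 2 * σ) + (Y : ℝ) ^ (2 + 2 * η - 2 * σ)) := by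
    intro i hi
    rw [Finset.mem_range] at hi
    set M : ℕ := X * 2 ^ i with hM
    have hM1 : 1 ≤ M := by rw [hM]; exact Nat.le_mul_of_pos_right X (by positivity) |>.trans' hX
    have hMX : X ≤ M := by rw [hM]; exact Nat.le_mul_of_pos_right X (by positivity)
    have hMY : M < Y := hJ i hi
    have hM0 : (0 : ℝ) < M := by exact_mod_cast hM1
    have h2M : X * 2 ^ (i + 1) = 2 * M := by rw [hM]; ring
    have h1 := hC (coeffB X Y) M σ (2 * U) V (Z.filter (fun ρ ↦ V ≤ ‖S i ρ‖)) hM1 (by linarith) hV0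
      (fun ρ hρ ↦ ⟨(hZ ρ (Finset.mem_filter.1 hρ).1).1, (hZ ρ (Finset.mem_filter.1 hρ).1).2.1⟩)
      (fun ρ hρ ↦ (hZ ρ (Finset.mem_filter.1 hρ).1).2.2)
      (fun ρ hρ ρ' hρ' hne ↦ hsep ρ (Finset.mem_filter.1 hρ).1 ρ' (Finset.mem_filter.1 hρ').1 hne)
      (fun ρ hρ ↦ by
        have := (Finset.mem_filter.1 hρ).2
        simp only [hS, h2M] at this
        exact this)
    have hB := sum_norm_coeffB_sq_le hd he₁ X Y hM1
    have hlog : Real.log (4 * M) ≤ Real.log (4 * Y) :=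
      Real.log_le_log (by positivity) (by exact_mod_cast (by omega : 4 * M ≤ 4 * Y))
    have hlog0 : 0 ≤ Real.log (4 * M) := Real.log_nonneg (by exact_mod_cast (by omega : 1 ≤ 4 * M))
    -- `(2U + 2M) M^{e₁} ≤ 2U X^{e₁} + 2 Y^{e₂}`
    have hgeom : (2 * U + 2 * M) * (M : ℝ) ^ (1 + 2 * η - 2 * σ) ≤
        2 * U * (X : ℝ) ^ (1 + 2 * η - 2 * σ) + 2 * (Y : ℝ) ^ (2 + 2 * η - 2 * σ) := by
      have hX0 : (0 : ℝ) < X := by exact_mod_cast hX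
      have h1 : (M : ℝ) ^ (1 + 2 * η - 2 * σ) ≤ (X : ℝ) ^ (1 + 2 * η - 2 * σ) :=
        Real.rpow_le_rpow_of_nonpos hX0 (by exact_mod_cast hMX) he₁
      have h2 : (M : ℝ) * (M : ℝ) ^ (1 + 2 * η - 2 * σ) = (M : ℝ) ^ (2 + 2 * η - 2 * σ) := by
        rw [show (2 : ℝ) + 2 * η - 2 * σ = 1 + (1 + 2 * η - 2 * σ) by ring, Real.rpow_add hM0,
          Real.rpow_one]
      have h3 : (M : ℝ) ^ (2 + 2 * η - 2 * σ) ≤ (Y : ℝ) ^ (2 + 2 * η - 2 * σ) :=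
        Real.rpow_le_rpow hM0.le (by exact_mod_cast hMY.le) he₂
      have h4 : 0 ≤ (M : ℝ) ^ (1 + 2 * η - 2 * σ) := Real.rpow_nonneg hM0.le _
      nlinarith
    have hVsq : V ^ 2 = 1 / (64 * J ^ 2) := by rw [hV]; field_simp; ring
    rw [hVsq] at h1
    refine h1.trans ?_
    rw [div_div_eq_mul_div, div_one]
    have hsum0 : 0 ≤ ∑ n ∈ Finset.Ioc M (2 * M), ‖coeffB X Y n‖ ^ 2 * (n : ℝ) ^ (-2 * σ) :=
      Finset.sum_nonneg fun n _ ↦ by positivity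
    have hpos1 : 0 ≤ C₀ * (2 * U + 2 * ↑M) := by positivity
    calc C₀ * (2 * U + 2 * ↑M) * Real.log (4 * ↑M) *
          (∑ n ∈ Finset.Ioc M (2 * M), ‖coeffB X Y n‖ ^ 2 * (n : ℝ) ^ (-2 * σ)) * (64 * ↑J ^ 2)
        ≤ C₀ * (2 * U + 2 * ↑M) * Real.log (4 * Y) *
          (C_d ^ 2 * (M : ℝ) ^ (1 + 2 * η - 2 * σ)) * (64 * ↑J ^ 2) := by
          have h3 : C₀ * (2 * U + 2 * ↑M) * Real.log (4 * ↑M) ≤ C₀ * (2 * U + 2 * ↑M) * Real.log (4 * Y) :=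
            mul_le_mul_of_nonneg_left hlog hpos1
          have h4 : 0 ≤ C₀ * (2 * U + 2 * ↑M) * Real.log (4 * Y) := mul_nonneg hpos1 hlogY0
          exact mul_le_mul_of_nonneg_right (mul_le_mul h3 hB hsum0 h4) (by positivity)
      _ = 64 * J ^ 2 * C₀ * C_d ^ 2 * Real.log (4 * Y) *
          ((2 * U + 2 * M) * (M : ℝ) ^ (1 + 2 * η - 2 * σ)) := by ring
      _ ≤ 64 * J ^ 2 * C₀ * C_d ^ 2 * Real.log (4 * Y) *
          (2 * U * (X : ℝ) ^ (1 + 2 * η - 2 * σ) + 2 * (Y : ℝ) ^ (2 + 2 * η - 2 * σ)) := by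
          refine mul_le_mul_of_nonneg_left hgeom ?_
          positivity
      _ = 128 * J ^ 2 * C₀ * C_d ^ 2 * Real.log (4 * Y) *
          (U * (X : ℝ) ^ (1 + 2 * η - 2 * σ) + (Y : ℝ) ^ (2 + 2 * η - 2 * σ)) := by ring
  -- sum over the blocks
  calc (Z.card : ℝ) ≤ ((Finset.range J).biUnion (fun i ↦ Z.filter (fun ρ ↦ V ≤ ‖S i ρ‖))).card := by
        exact_mod_cast Finset.card_le_card hcover
    _ ≤ ∑ i ∈ Finset.range J, ((Z.filter (fun ρ ↦ V ≤ ‖S i ρ‖)).card : ℝ) := by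
        exact_mod_cast Finset.card_biUnion_le
    _ ≤ ∑ i ∈ Finset.range J, 128 * J ^ 2 * C₀ * C_d ^ 2 * Real.log (4 * Y) *
          (U * (X : ℝ) ^ (1 + 2 * η - 2 * σ) + (Y : ℝ) ^ (2 + 2 * η - 2 * σ)) :=
        Finset.sum_le_sum hblock
    _ = _ := by rw [Finset.sum_const, Finset.card_range, nsmul_eq_mul]; ring

/-! ### The mean square of the mollifier -/

/-- `M_X(1/2 + it) = ∑_{d ≤ X} (μ(d) d^{-1/2}) d^{-it}`. [folklore] -/
theorem mollifier_half_line (X : ℕ) (t : ℝ) :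
    ZeroDetect.mollifier X (1 / 2 + t * I) =
      ∑ d ∈ Finset.Icc 1 X, (((ArithmeticFunction.moebius d : ℤ) : ℂ) *
        ((((d : ℝ) ^ (-(1 / 2 : ℝ)) : ℝ) : ℂ))) * (d : ℂ) ^ (-((t : ℂ) * I)) := by
  unfold ZeroDetect.mollifier
  refine Finset.sum_congr rfl fun d hd ↦ ?_
  simp only [Finset.mem_Icc] at hd
  have hd0 : (d : ℂ) ≠ 0 := by exact_mod_cast (by omega : d ≠ 0)
  rw [show -(1 / 2 + (t : ℂ) * I) = (((-(1 / 2 : ℝ)) : ℝ) : ℂ) + (-((t : ℂ) * I)) by push_cast; ring,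
    Complex.cpow_add _ _ hd0, Complex.ofReal_cpow (Nat.cast_nonneg d)]
  push_cast
  ring

/-- Continuity of `t ↦ M_X(1/2 + it)`. [folklore] -/
theorem continuous_mollifier_half_line (X : ℕ) :
    Continuous fun t : ℝ ↦ ZeroDetect.mollifier X (1 / 2 + t * I) :=
  (ZeroDetect.differentiable_mollifier X).continuous.comp (by fun_prop)

/-- **Mean square of the mollifier on the critical line**: for `X ≥ 1`, `T > 0`,
`∫_0^T |M_X(1/2+it)|² dt ≤ (5T + 18X)(1 + log X)` (the weak mean value theorem
`Literature.NumberTheory.LFunctions.dirichletPolynomial_meanSquare_le` with `a_d = μ(d) d^{-1/2}`, `∑ |a_d|² ≤ ∑_{d≤X} 1/d`).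
[cite: Ivic1985, Theorem 5.2 (weak form), applied to M_X] -/
theorem meanSquare_mollifier_le (X : ℕ) {T : ℝ} (hT : 0 < T) :
    ∫ t in (0 : ℝ)..T, ‖ZeroDetect.mollifier X (1 / 2 + t * I)‖ ^ 2 ≤
      (5 * T + 18 * X) * (1 + Real.log X) := by
  set a : ℕ → ℂ := fun d ↦ ((ArithmeticFunction.moebius d : ℤ) : ℂ) *
    ((((d : ℝ) ^ (-(1 / 2 : ℝ)) : ℝ) : ℂ)) with ha
  have hMVT := Literature.NumberTheory.LFunctions.dirichletPolynomial_meanSquare_le a X hT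
  have he : ∀ t : ℝ, ZeroDetect.mollifier X (1 / 2 + t * I) =
      ∑ d ∈ Finset.Icc 1 X, a d * (d : ℂ) ^ (-((t : ℂ) * I)) := fun t ↦ mollifier_half_line X t
  have hcont : Continuous fun t : ℝ ↦ ‖ZeroDetect.mollifier X (1 / 2 + t * I)‖ ^ 2 :=
    (continuous_mollifier_half_line X).norm.pow 2
  calc ∫ t in (0 : ℝ)..T, ‖ZeroDetect.mollifier X (1 / 2 + t * I)‖ ^ 2
      ≤ ∫ t in (-T)..T, ‖ZeroDetect.mollifier X (1 / 2 + t * I)‖ ^ 2 :=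
        intervalIntegral.integral_mono_interval (by linarith) hT.le le_rfl
          (Eventually.of_forall fun t ↦ by positivity) (hcont.intervalIntegrable _ _)
    _ = ∫ t in (-T)..T, ‖∑ d ∈ Finset.Icc 1 X, a d * (d : ℂ) ^ (-((t : ℂ) * I))‖ ^ 2 := by
        simp_rw [he]
    _ ≤ (5 * T + 18 * X) * ∑ d ∈ Finset.Icc 1 X, ‖a d‖ ^ 2 := hMVT
    _ ≤ (5 * T + 18 * X) * (1 + Real.log X) := by
        refine mul_le_mul_of_nonneg_left ?_ (by positivity)
        calc ∑ d ∈ Finset.Icc 1 X, ‖a d‖ ^ 2 ≤ ∑ d ∈ Finset.Icc 1 X, (1 : ℝ) / d := by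
              refine Finset.sum_le_sum fun d hd ↦ ?_
              simp only [Finset.mem_Icc] at hd
              have hd0 : (0 : ℝ) < d := by exact_mod_cast hd.1
              rw [ha, norm_mul, mul_pow, Complex.norm_real, Real.norm_of_nonneg (Real.rpow_nonneg hd0.le _),
                ← Real.rpow_natCast ((d : ℝ) ^ (-(1 / 2 : ℝ))), ← Real.rpow_mul hd0.le]
              have e : (-(1 / 2 : ℝ)) * ((2 : ℕ) : ℝ) = -1 := by norm_num
              rw [e, Real.rpow_neg_one, one_div]
              have hμ : ‖((ArithmeticFunction.moebius d : ℤ) : ℂ)‖ ^ 2 ≤ 1 := by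
                have := ZeroDetect.norm_moebiusTruncSeq_le d d
                rw [ZeroDetect.moebiusTruncSeq_apply, if_pos le_rfl] at this
                exact pow_le_one₀ (norm_nonneg _) this
              exact mul_le_of_le_one_left (by positivity) hμ
          _ ≤ 1 + Real.log X := by
              have h := harmonic_le_one_add_log X
              have e : ∑ d ∈ Finset.Icc 1 X, (1 : ℝ) / d = (harmonic X : ℝ) := by
                rw [harmonic_eq_sum_Icc]; push_cast
                exact Finset.sum_congr rfl fun d _ ↦ by simp
              rw [e]; exact h

/-! ### The dichotomy for a single zero -/

/-- **Class I or Class II.** Let `1/2 < σ`, `X ≥ 1`, `Y ≥ 4` with `Y ≤ X·2^J`, `1 ≤ U`, `X ≤ U`,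
and suppose the residue term is small, `2 √Y (1 + log X)/U³ ≤ 1/8`, and `Y^{σ-1/2} ≥ 256`. Then
every zero `ρ = β + iγ` of `ζ` with `β ≥ σ`, `U < γ ≤ 2U` satisfies either the Class-I condition
`‖∑_{X<n≤X2^J} b(n) n^{-ρ}‖ ≥ 1/8` or the (truncated) Class-II condition
`∫_{-U}^{U} |K(1/2-β+iy)| |ζ(1/2+i(γ+y))| |M_X(1/2+i(γ+y))| dy ≥ (π/4) Y^{σ-1/2}`.
[cite: Ivic1985, §11.2 (11.8)–(11.10)] -/
theorem perZero_dichotomy {σ : ℝ} (hσ : 1 / 2 < σ) {X Y J : ℕ} (hX : 1 ≤ X) (hY4 : 4 ≤ Y)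
    (hJ : Y ≤ X * 2 ^ J) {U : ℝ} (hU : 1 ≤ U) (hXU : (X : ℝ) ≤ U)
    (hres : 2 * Real.sqrt Y * (1 + Real.log X) / U ^ 3 ≤ 1 / 8)
    (hY256 : 256 ≤ (Y : ℝ) ^ (σ - 1 / 2))
    {ρ : ℂ} (hζ : riemannZeta ρ = 0) (hβ : σ ≤ ρ.re) (hγ1 : U < ρ.im) (hγ2 : ρ.im ≤ 2 * U) :
    1 / 8 ≤ ‖∑ n ∈ Finset.Ioc X (X * 2 ^ J), coeffB X Y n * (n : ℂ) ^ (-ρ)‖ ∨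
    π / 4 * (Y : ℝ) ^ (σ - 1 / 2) ≤ ∫ y in (-U)..U,
      ‖ZeroDetect.rieszK (((1 / 2 - ρ.re : ℝ) : ℂ) + y * I)‖ *
        (‖riemannZeta (1 / 2 + (ρ.im + y) * I)‖ * ‖ZeroDetect.mollifier X (1 / 2 + (ρ.im + y) * I)‖) := by
  have hY1 : 1 ≤ Y := by omega
  have hY0 : (0 : ℝ) < Y := by exact_mod_cast (by omega : 0 < Y)
  have hYr : (4 : ℝ) ≤ Y := by exact_mod_cast hY4
  have hβ1 : ρ.re < 1 := by
    by_contra h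
    exact riemannZeta_ne_zero_of_one_le_re (not_lt.1 h) hζ
  have hβ0 : 1 / 2 < ρ.re := by linarith
  have hγ0 : 0 < ρ.im := by linarith
  have hD := ZeroDetect.zeroDetection_norm_ineq hX hY1 hβ0 hβ1 hζ
  rw [sum_Ioc_eq_sum_coeffB (by omega) hJ] at hD
  set S := ∑ n ∈ Finset.Ioc X (X * 2 ^ J), coeffB X Y n * (n : ℂ) ^ (-ρ) with hS
  set Iint := ∫ y : ℝ, ‖ZeroDetect.rieszK (((1 / 2 - ρ.re : ℝ) : ℂ) + y * I)‖ *
    (‖riemannZeta (1 / 2 + (ρ.im + y) * I)‖ * ‖ZeroDetect.mollifier X (1 / 2 + (ρ.im + y) * I)‖)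
    with hI
  -- `(1 - 1/Y)² ≥ 1/2`
  have hlhs : (1 : ℝ) / 2 ≤ ((1 : ℝ) - 1 / Y) ^ 2 := by
    have h1 : (3 : ℝ) / 4 ≤ 1 - 1 / Y := by
      rw [le_sub_comm, div_le_iff₀ hY0]; linarith
    nlinarith
  -- the residue term is `≤ 1/8`
  have hresid : (Y : ℝ) ^ (1 - ρ.re) * ‖ZeroDetect.rieszK (1 - ρ)‖ * (1 + Real.log X) ≤ 1 / 8 := by
    have h1 : (Y : ℝ) ^ (1 - ρ.re) ≤ Real.sqrt Y := by
      rw [Real.sqrt_eq_rpow]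
      exact Real.rpow_le_rpow_of_exponent_le (by linarith) (by linarith)
    have h2 : ‖ZeroDetect.rieszK (1 - ρ)‖ ≤ 2 / U ^ 3 := by
      refine (norm_rieszK_one_sub_le hγ0).trans ?_
      exact div_le_div_of_nonneg_left (by norm_num) (by positivity)
        (pow_le_pow_left₀ (by linarith) hγ1.le 3)
    have hlogX : 0 ≤ 1 + Real.log X := by
      have : 0 ≤ Real.log X := Real.log_nonneg (by exact_mod_cast hX)
      linarith
    calc (Y : ℝ) ^ (1 - ρ.re) * ‖ZeroDetect.rieszK (1 - ρ)‖ * (1 + Real.log X)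
        ≤ Real.sqrt Y * (2 / U ^ 3) * (1 + Real.log X) := by
          refine mul_le_mul_of_nonneg_right (mul_le_mul h1 h2 (norm_nonneg _) (Real.sqrt_nonneg _)) hlogX
      _ = 2 * Real.sqrt Y * (1 + Real.log X) / U ^ 3 := by ring
      _ ≤ 1 / 8 := hres
  by_cases hcase : 1 / 8 ≤ ‖S‖
  · exact Or.inl hcase
  · right
    rw [not_le] at hcase
    -- the Class-II lower bound for the full integral
    have hq : (1 : ℝ) / 4 ≤ 1 / (2 * π) * (Y : ℝ) ^ (1 / 2 - ρ.re) * Iint := by linarith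
    have hYpow : 0 < (Y : ℝ) ^ (ρ.re - 1 / 2) := Real.rpow_pos_of_pos hY0 _
    have hinv : (Y : ℝ) ^ (1 / 2 - ρ.re) = ((Y : ℝ) ^ (ρ.re - 1 / 2))⁻¹ := by
      rw [← Real.rpow_neg hY0.le]; congr 1; ring
    have hIge : π / 2 * (Y : ℝ) ^ (ρ.re - 1 / 2) ≤ Iint := by
      rw [hinv] at hq
      have h2 : (1 : ℝ) / 4 * (2 * π * (Y : ℝ) ^ (ρ.re - 1 / 2)) ≤
          (1 / (2 * π) * ((Y : ℝ) ^ (ρ.re - 1 / 2))⁻¹ * Iint) * (2 * π * (Y : ℝ) ^ (ρ.re - 1 / 2)) :=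
        mul_le_mul_of_nonneg_right hq (by positivity)
      have e : (1 / (2 * π) * ((Y : ℝ) ^ (ρ.re - 1 / 2))⁻¹ * Iint) * (2 * π * (Y : ℝ) ^ (ρ.re - 1 / 2)) =
          Iint := by
        field_simp
      rw [e] at h2
      linarith
    have hYσ : (Y : ℝ) ^ (σ - 1 / 2) ≤ (Y : ℝ) ^ (ρ.re - 1 / 2) :=
      Real.rpow_le_rpow_of_exponent_le (by linarith) (by linarith)
    have hA0 : 0 < π / 2 * (Y : ℝ) ^ (σ - 1 / 2) := by positivity
    have hA : π / 2 * (Y : ℝ) ^ (σ - 1 / 2) ≤ Iint := by nlinarith [Real.pi_pos]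
    have htr := classTwo_truncate (X := X) (c := 1 / 2 - ρ.re) hU hXU hγ1.le hγ2 hA0 (by
      simpa [hI] using hA)
    have : π / 4 * (Y : ℝ) ^ (σ - 1 / 2) ≤ π / 2 * (Y : ℝ) ^ (σ - 1 / 2) - 64 * π := by
      nlinarith [Real.pi_pos]
    refine this.trans (htr.trans_eq ?_)
    push_cast
    rfl

/-! ### The well-spaced count from the two classes -/

/-- Ingham's exponent `κ₀(σ) = 3(1-σ)/(2-σ) = a(2-2σ)` with `a = 3/(4-2σ)`, and `3 - 4a(σ-1/2) = 3κ₀`.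
[cite: Ivic1985, §11.3 proof of (11.22)] -/
theorem ingham_exponent_identities {σ : ℝ} (hσ1 : σ < 1) :
    3 / (4 - 2 * σ) * (2 - 2 * σ) = 3 * (1 - σ) / (2 - σ) ∧
    3 - 4 * (3 / (4 - 2 * σ)) * (σ - 1 / 2) = 3 * (3 * (1 - σ) / (2 - σ)) := by
  have h1 : (4 : ℝ) - 2 * σ ≠ 0 := by linarith
  have h2 : (2 : ℝ) - σ ≠ 0 := by linarith
  constructor
  · field_simp; ring
  · field_simp; ring

/-- `1 + log U ≤ (1 + 4/η) U^{η/4}` hence `(1 + log U)⁴ ≤ (1 + 4/η)⁴ U^η` (`U ≥ 1`, `η > 0`).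
[folklore] -/
theorem one_add_log_pow_four_le {η U : ℝ} (hη : 0 < η) (hU : 1 ≤ U) :
    (1 + Real.log U) ^ 4 ≤ (1 + 4 / η) ^ 4 * U ^ η := by
  have hU0 : 0 < U := by linarith
  have h1 : Real.log U ≤ U ^ (η / 4) / (η / 4) := Real.log_le_rpow_div hU0.le (by positivity)
  have h2 : 1 ≤ U ^ (η / 4) := Real.one_le_rpow hU (by positivity)
  have h3 : 1 + Real.log U ≤ (1 + 4 / η) * U ^ (η / 4) := by
    rw [add_mul, one_mul]
    have : U ^ (η / 4) / (η / 4) = 4 / η * U ^ (η / 4) := by field_simp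
    linarith
  have h0 : 0 ≤ 1 + Real.log U := by linarith [Real.log_nonneg hU]
  calc (1 + Real.log U) ^ 4 ≤ ((1 + 4 / η) * U ^ (η / 4)) ^ 4 := pow_le_pow_left₀ h0 h3 4
    _ = (1 + 4 / η) ^ 4 * (U ^ (η / 4)) ^ 4 := mul_pow _ _ _
    _ = (1 + 4 / η) ^ 4 * U ^ η := by
        rw [← Real.rpow_natCast (U ^ (η / 4)), ← Real.rpow_mul hU0.le]; norm_num

/-- Cube roots: from `x³ ≤ y` (`x, y ≥ 0`) infer `x ≤ y^{1/3}`. [folklore] -/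
theorem le_rpow_third_of_pow_three_le {x y : ℝ} (hx : 0 ≤ x) (h : x ^ 3 ≤ y) :
    x ≤ y ^ (1 / 3 : ℝ) := by
  have e : (x ^ 3) ^ ((3 : ℕ)⁻¹ : ℝ) = x := Real.pow_rpow_inv_natCast hx (by norm_num)
  rw [show (1 / 3 : ℝ) = ((3 : ℕ)⁻¹ : ℝ) by norm_num, ← e]
  exact Real.rpow_le_rpow (by positivity) h (by positivity)

/-- **Class I, final form.** With `X ≥ U/2`, `Y ≤ U^a`, `J ≤ 3(1 + log U)`, `a ≤ 3/2`,
`a(2-2σ) = κ₀ ≥ 2 - 2σ`: the Class-I zeros number `≤ C₁ (1 + log U)⁴ U^{κ₀+3η}`,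
`C₁ = 20736 C₀ C_d²`. [cite: Ivic1985, §11.3 proof of (11.22), bound for R₁] -/
theorem classOne_final {C₀ : ℝ} (hC₀0 : 0 ≤ C₀) (hC₀ : IsClassOneConst C₀)
    {C_d η σ a κ₀ : ℝ} (hd : ∀ n : ℕ, (n.divisors.card : ℝ) ≤ C_d * (n : ℝ) ^ η)
    (hη : 0 < η) (hησ : η < σ - 1 / 2) (hσ1 : σ < 1) (ha32 : a ≤ 3 / 2) (haκ : a * (2 - 2 * σ) = κ₀)
    (hκ₂ : 2 - 2 * σ ≤ κ₀)
    {X Y J : ℕ} (hX1 : 1 ≤ X) (hY1 : 1 ≤ Y) (hJmin : ∀ i < J, X * 2 ^ i < Y) {U : ℝ} (hU1 : 1 ≤ U)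
    (hXU2 : U / 2 ≤ X) (hYU : (Y : ℝ) ≤ U ^ a) (hJle : (J : ℝ) ≤ 3 * (1 + Real.log U))
    (Z₁ : Finset ℂ) (hZ₁ : ∀ ρ ∈ Z₁, σ ≤ ρ.re ∧ ρ.re ≤ σ + 1 / 2 ∧ |ρ.im| ≤ 2 * U)
    (hsep : ∀ ρ ∈ Z₁, ∀ ρ' ∈ Z₁, ρ ≠ ρ' → 1 ≤ |ρ.im - ρ'.im|)
    (hlarge : ∀ ρ ∈ Z₁, 1 / 8 ≤ ‖∑ n ∈ Finset.Ioc X (X * 2 ^ J), coeffB X Y n * (n : ℂ) ^ (-ρ)‖) :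
    (Z₁.card : ℝ) ≤ 20736 * C₀ * C_d ^ 2 * (1 + Real.log U) ^ 4 * U ^ (κ₀ + 3 * η) := by
  have hU0 : 0 < U := by linarith
  set L := Real.log U with hL
  have hL0 : 0 ≤ L := Real.log_nonneg hU1
  have hX0 : (0 : ℝ) < X := by exact_mod_cast hX1
  have hY0 : (0 : ℝ) < Y := by exact_mod_cast (by omega : 0 < Y)
  have he₁ : 1 + 2 * η - 2 * σ ≤ 0 := by linarith
  have he₂ : 0 ≤ 2 + 2 * η - 2 * σ := by linarith
  have h1 := classOne_count hC₀0 hC₀ hd he₁ he₂ hX1 hY1 hJmin hU1 Z₁ hZ₁ hsep hlarge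
  refine h1.trans ?_
  have hJ3 : (J : ℝ) ^ 3 ≤ 27 * (1 + L) ^ 3 := by
    calc (J : ℝ) ^ 3 ≤ (3 * (1 + L)) ^ 3 := pow_le_pow_left₀ (Nat.cast_nonneg _) hJle 3
      _ = 27 * (1 + L) ^ 3 := by ring
  have hlogY : Real.log Y ≤ a * L := by
    calc Real.log Y ≤ Real.log (U ^ a) := Real.log_le_log hY0 hYU
      _ = a * L := by rw [Real.log_rpow hU0]
  have hlog4Y : Real.log (4 * Y) ≤ 2 * (1 + L) := by
    rw [Real.log_mul (by norm_num) hY0.ne']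
    have hl4 : Real.log 4 ≤ 2 := by
      have h2 : Real.log 2 ≤ 1 := Real.log_two_lt_d9.le.trans (by norm_num)
      have : Real.log 4 = 2 * Real.log 2 := by
        rw [show (4 : ℝ) = 2 ^ 2 by norm_num, Real.log_pow]; norm_num
      linarith
    nlinarith
  have hXe : U * (X : ℝ) ^ (1 + 2 * η - 2 * σ) ≤ 2 * U ^ (κ₀ + 3 * η) := by
    have h2 : (X : ℝ) ^ (1 + 2 * η - 2 * σ) ≤ (U / 2) ^ (1 + 2 * η - 2 * σ) :=
      Real.rpow_le_rpow_of_nonpos (by positivity) hXU2 he₁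
    have h3 : (U / 2) ^ (1 + 2 * η - 2 * σ) = U ^ (1 + 2 * η - 2 * σ) * 2 ^ (-(1 + 2 * η - 2 * σ)) := by
      rw [Real.div_rpow hU0.le (by norm_num), Real.rpow_neg (by norm_num), div_eq_mul_inv]
    have h4 : (2 : ℝ) ^ (-(1 + 2 * η - 2 * σ)) ≤ 2 := by
      calc (2 : ℝ) ^ (-(1 + 2 * η - 2 * σ)) ≤ 2 ^ (1 : ℝ) :=
            Real.rpow_le_rpow_of_exponent_le (by norm_num) (by linarith)
        _ = 2 := Real.rpow_one _
    have h5 : U * U ^ (1 + 2 * η - 2 * σ) = U ^ (2 + 2 * η - 2 * σ) := by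
      rw [show (2 : ℝ) + 2 * η - 2 * σ = 1 + (1 + 2 * η - 2 * σ) by ring, Real.rpow_add hU0,
        Real.rpow_one]
    have h6 : U ^ (2 + 2 * η - 2 * σ) ≤ U ^ (κ₀ + 3 * η) :=
      Real.rpow_le_rpow_of_exponent_le hU1 (by linarith)
    have hUp0 : 0 ≤ U ^ (1 + 2 * η - 2 * σ) := by positivity
    calc U * (X : ℝ) ^ (1 + 2 * η - 2 * σ) ≤ U * ((U / 2) ^ (1 + 2 * η - 2 * σ)) :=
          mul_le_mul_of_nonneg_left h2 hU0.le
      _ = U * U ^ (1 + 2 * η - 2 * σ) * 2 ^ (-(1 + 2 * η - 2 * σ)) := by rw [h3]; ring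
      _ ≤ U * U ^ (1 + 2 * η - 2 * σ) * 2 :=
          mul_le_mul_of_nonneg_left h4 (by positivity)
      _ = 2 * U ^ (2 + 2 * η - 2 * σ) := by rw [← h5]; ring
      _ ≤ 2 * U ^ (κ₀ + 3 * η) := by linarith
  have hYe : (Y : ℝ) ^ (2 + 2 * η - 2 * σ) ≤ U ^ (κ₀ + 3 * η) := by
    calc (Y : ℝ) ^ (2 + 2 * η - 2 * σ) ≤ (U ^ a) ^ (2 + 2 * η - 2 * σ) :=
          Real.rpow_le_rpow hY0.le hYU he₂
      _ = U ^ (a * (2 - 2 * σ) + 2 * a * η) := by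
          rw [← Real.rpow_mul hU0.le]; congr 1; ring
      _ ≤ U ^ (κ₀ + 3 * η) := by
          refine Real.rpow_le_rpow_of_exponent_le hU1 ?_
          rw [haκ]; nlinarith
  have hsum : U * (X : ℝ) ^ (1 + 2 * η - 2 * σ) + (Y : ℝ) ^ (2 + 2 * η - 2 * σ) ≤
      3 * U ^ (κ₀ + 3 * η) := by linarith
  have hlog0 : 0 ≤ Real.log (4 * (Y : ℝ)) := Real.log_nonneg (by
    have : (1 : ℝ) ≤ Y := by exact_mod_cast hY1
    linarith)
  calc 128 * (J : ℝ) ^ 3 * C₀ * C_d ^ 2 * Real.log (4 * Y) *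
        (U * (X : ℝ) ^ (1 + 2 * η - 2 * σ) + (Y : ℝ) ^ (2 + 2 * η - 2 * σ))
      ≤ 128 * (27 * (1 + L) ^ 3) * C₀ * C_d ^ 2 * (2 * (1 + L)) * (3 * U ^ (κ₀ + 3 * η)) := by
        gcongr
    _ = 20736 * C₀ * C_d ^ 2 * (1 + L) ^ 4 * U ^ (κ₀ + 3 * η) := by ring

/-- **Class II, final form.** With `Y ≥ U^a/2`, `3 - 4a(σ-1/2) = 3κ₀`, the fourth moment on
`[0, 3U]` bounded by `C₄' U^{1+η}` and `X ≤ U`: the Class-II zeros number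
`≤ C₂^{1/3} (1 + log U)⁴ U^{κ₀+3η}` with an explicit `C₂`.
[cite: Ivic1985, §11.3 proof of (11.22), (11.20) with M(4) = 1] -/
theorem classTwo_final {σ a κ₀ η C₄' : ℝ} (hσ : 1 / 2 < σ) (hη : 0 < η)
    (hid : 3 - 4 * a * (σ - 1 / 2) = 3 * κ₀)
    {X Y : ℕ} (hX1 : 1 ≤ X) {U : ℝ} (hU1 : 1 ≤ U) (hXU : (X : ℝ) ≤ U) (hY1 : 1 ≤ Y)
    (hYU2 : U ^ a / 2 ≤ Y)
    (hI4 : ∫ t in (0 : ℝ)..(3 * U), ‖riemannZeta (1 / 2 + t * I)‖ ^ 4 ≤ C₄' * U ^ (1 + η))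
    (Z₂ : Finset ℂ) (hZ₂ : ∀ ρ ∈ Z₂, σ ≤ ρ.re ∧ ρ.re < 1 ∧ U < ρ.im ∧ ρ.im ≤ 2 * U)
    (hsep : ∀ ρ ∈ Z₂, ∀ ρ' ∈ Z₂, ρ ≠ ρ' → 1 ≤ |ρ.im - ρ'.im|)
    (hlarge : ∀ ρ ∈ Z₂, π / 4 * (Y : ℝ) ^ (σ - 1 / 2) ≤ ∫ y in (-U)..U,
      ‖ZeroDetect.rieszK (((1 / 2 - ρ.re : ℝ) : ℂ) + y * I)‖ *
        (‖riemannZeta (1 / 2 + (ρ.im + y) * I)‖ * ‖ZeroDetect.mollifier X (1 / 2 + (ρ.im + y) * I)‖)) :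
    (Z₂.card : ℝ) ≤ (((π / 4) ^ 4)⁻¹ * (2 * π / (σ - 1 / 2) ^ 2) *
        (2 / (σ - 1 / 2) * (3 * ((σ - 1 / 2) ^ 2)⁻¹ + 4)) ^ 3 * |C₄'| * 33 ^ 2 * 2 ^ (4 * (σ - 1 / 2))) ^ (1 / 3 : ℝ) *
      (1 + Real.log U) ^ 4 * U ^ (κ₀ + 3 * η) := by
  have hU0 : 0 < U := by linarith
  set L := Real.log U with hL
  have hL0 : 0 ≤ L := Real.log_nonneg hU1
  have hL1 : 1 ≤ 1 + L := by linarith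
  set η₀ : ℝ := σ - 1 / 2 with hη₀
  have hη₀0 : 0 < η₀ := by rw [hη₀]; linarith
  have hY0 : (0 : ℝ) < Y := by exact_mod_cast (by omega : 0 < Y)
  have hlogX : Real.log X ≤ L := Real.log_le_log (by exact_mod_cast hX1) hXU
  set κK : ℝ := 2 * π / η₀ ^ 2 with hκK
  set Bs : ℝ := 2 / η₀ * (3 * (η₀ ^ 2)⁻¹ + 4) with hBs
  set C₂ : ℝ := ((π / 4) ^ 4)⁻¹ * κK * Bs ^ 3 * |C₄'| * 33 ^ 2 * 2 ^ (4 * η₀) with hC₂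
  have hC₂0 : 0 ≤ C₂ := by positivity
  set A : ℝ := π / 4 * (Y : ℝ) ^ η₀ with hA
  have hA0 : 0 < A := by positivity
  have hlarge' : ∀ ρ ∈ Z₂, A ≤ ∫ y in (-U)..U,
      ‖ZeroDetect.rieszK (((1 / 2 - ρ.re : ℝ) : ℂ) + y * I)‖ *
        ((fun t : ℝ ↦ ‖riemannZeta (1 / 2 + t * I)‖) (ρ.im + y) *
          (fun t : ℝ ↦ ‖ZeroDetect.mollifier X (1 / 2 + t * I)‖) (ρ.im + y)) := by
    intro ρ hρ
    have hd := hlarge ρ hρ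
    push_cast at hd ⊢
    exact hd
  have hcore := classTwo_core hη₀0 hU1 hA0 (ζf := fun t : ℝ ↦ ‖riemannZeta (1 / 2 + t * I)‖)
    (Mf := fun t : ℝ ↦ ‖ZeroDetect.mollifier X (1 / 2 + t * I)‖) LFunctions.continuous_riemannZeta_line.norm
    (continuous_mollifier_half_line X).norm (fun t ↦ norm_nonneg _) (fun t ↦ norm_nonneg _) Z₂
    (fun ρ hρ ↦ by
      obtain ⟨hb, hb1, -, -⟩ := hZ₂ ρ hρ
      exact ⟨by rw [hη₀]; linarith, by linarith⟩)
    (fun ρ hρ ↦ by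
      obtain ⟨-, -, hg1, hg2⟩ := hZ₂ ρ hρ
      exact ⟨hg1.le, hg2⟩)
    hsep hlarge'
  have hI2 : ∫ t in (0 : ℝ)..(3 * U), ‖ZeroDetect.mollifier X (1 / 2 + t * I)‖ ^ 2 ≤ 33 * U * (1 + L) := by
    refine (meanSquare_mollifier_le X (by linarith : (0 : ℝ) < 3 * U)).trans ?_
    have h1 : (5 : ℝ) * (3 * U) + 18 * X ≤ 33 * U := by linarith
    have h2 : 1 + Real.log X ≤ 1 + L := by linarith
    have h3 : 0 ≤ 1 + Real.log (X : ℝ) := by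
      linarith [Real.log_nonneg (show (1 : ℝ) ≤ X by exact_mod_cast hX1)]
    exact mul_le_mul h1 h2 h3 (by positivity)
  have hI4' : ∫ t in (0 : ℝ)..(3 * U), ‖riemannZeta (1 / 2 + t * I)‖ ^ 4 ≤ |C₄'| * U ^ (1 + η) :=
    hI4.trans (mul_le_mul_of_nonneg_right (le_abs_self _) (by positivity))
  have hI20 : 0 ≤ ∫ t in (0 : ℝ)..(3 * U), ‖ZeroDetect.mollifier X (1 / 2 + t * I)‖ ^ 2 :=
    intervalIntegral.integral_nonneg (by linarith) fun t _ ↦ by positivity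
  -- `A⁴ ≥ (π/4)⁴ 2^{-4η₀} U^{4aη₀}`
  have hA4 : (π / 4) ^ 4 * (2 ^ (4 * η₀))⁻¹ * U ^ (4 * a * η₀) ≤ A ^ 4 := by
    rw [hA, mul_pow]
    have h1 : (U ^ a / 2) ^ (4 * η₀) ≤ (Y : ℝ) ^ (4 * η₀) :=
      Real.rpow_le_rpow (by positivity) hYU2 (by positivity)
    have h2 : (U ^ a / 2) ^ (4 * η₀) = (2 ^ (4 * η₀))⁻¹ * U ^ (4 * a * η₀) := by
      rw [Real.div_rpow (by positivity) (by norm_num), ← Real.rpow_mul hU0.le, div_eq_inv_mul]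
      congr 2; ring
    have h3 : ((Y : ℝ) ^ η₀) ^ 4 = (Y : ℝ) ^ (4 * η₀) := by
      rw [← Real.rpow_natCast, ← Real.rpow_mul hY0.le]; congr 1; push_cast; ring
    rw [h3, mul_assoc]
    exact mul_le_mul_of_nonneg_left (h2 ▸ h1) (by positivity)
  -- `|Z₂|³ ≤ C₂ U^{3κ₀ + η} (1+L)²`
  have hcube : (Z₂.card : ℝ) ^ 3 ≤ C₂ * (U ^ (3 * κ₀ + η) * (1 + L) ^ 2) := by
    have h1 : A ^ 4 * (Z₂.card : ℝ) ^ 3 ≤ κK * Bs ^ 3 * (|C₄'| * U ^ (1 + η)) *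
        (33 * U * (1 + L)) ^ 2 := by
      refine hcore.trans ?_
      have hκK0 : 0 ≤ κK := by positivity
      have hBs0 : 0 ≤ Bs := by positivity
      exact mul_le_mul (mul_le_mul_of_nonneg_left hI4' (by positivity))
        (pow_le_pow_left₀ hI20 hI2 2) (by positivity) (by positivity)
    have hlow : 0 < (π / 4) ^ 4 * (2 ^ (4 * η₀))⁻¹ * U ^ (4 * a * η₀) := by positivity
    have h2 : ((π / 4) ^ 4 * (2 ^ (4 * η₀))⁻¹ * U ^ (4 * a * η₀)) * (Z₂.card : ℝ) ^ 3 ≤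
        κK * Bs ^ 3 * (|C₄'| * U ^ (1 + η)) * (33 * U * (1 + L)) ^ 2 :=
      (mul_le_mul_of_nonneg_right hA4 (by positivity)).trans h1
    rw [← le_div_iff₀' hlow] at h2
    refine h2.trans (le_of_eq ?_)
    have hUpow : U ^ (1 + η) * U ^ 2 / U ^ (4 * a * η₀) = U ^ (3 * κ₀ + η) := by
      rw [← Real.rpow_two, ← Real.rpow_add hU0, ← Real.rpow_sub hU0]
      congr 1
      linarith
    rw [hC₂, ← hUpow]
    field_simp
  -- cube roots (crudely)
  have hW : U ^ (3 * κ₀ + η) * (1 + L) ^ 2 ≤ (U ^ (κ₀ + 3 * η) * (1 + L) ^ 4) ^ 3 := by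
    have h1 : U ^ (3 * κ₀ + η) ≤ (U ^ (κ₀ + 3 * η)) ^ 3 := by
      rw [← Real.rpow_natCast, ← Real.rpow_mul hU0.le]
      exact Real.rpow_le_rpow_of_exponent_le hU1 (by push_cast; linarith)
    have h2 : (1 + L) ^ 2 ≤ ((1 + L) ^ 4) ^ 3 := by
      rw [← pow_mul]; exact pow_le_pow_right₀ hL1 (by norm_num)
    rw [mul_pow]
    exact mul_le_mul h1 h2 (by positivity) (by positivity)
  have h3 : (Z₂.card : ℝ) ^ 3 ≤ C₂ * (U ^ (κ₀ + 3 * η) * (1 + L) ^ 4) ^ 3 :=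
    hcube.trans (mul_le_mul_of_nonneg_left hW hC₂0)
  have h4 := le_rpow_third_of_pow_three_le (Nat.cast_nonneg _) h3
  refine h4.trans (le_of_eq ?_)
  rw [Real.mul_rpow hC₂0 (by positivity), show (1 / 3 : ℝ) = ((3 : ℕ)⁻¹ : ℝ) by norm_num,
    Real.pow_rpow_inv_natCast (by positivity) (by norm_num)]
  simp only [hC₂, hκK, hBs, hη₀]
  ring

-- the assembly of the two classes carries a large context (thresholds, constants, exponents); the
-- default heartbeat budget does not suffice for its `positivity`/`linarith`/`gcongr` calls.
set_option maxHeartbeats 800000 in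
/-- **The well-spaced count** (Ivić §11.3, proof of (11.22), with `X = T`, `Y = T^{3/(4-2σ)}`):
assuming the weak fourth moment, for `1/2 < σ < 1` and `0 < η < σ - 1/2`, there are
`U₀ ≥ 1` and `C` such that every finite set of zeros `ρ` of `ζ` with `Re ρ ≥ σ`, `U < Im ρ ≤ 2U`,
ordinates pairwise `≥ 1` apart, has at most `C U^{κ₀+4η}` elements for `U ≥ U₀`,
`κ₀ = 3(1-σ)/(2-σ)`. [cite: Ivic1985, Theorem 11.1 (11.22) and its proof, §11.2–§11.3] -/
theorem wellSpaced_of_fourthMoment (h4 : zetaFourthMomentWeak) {σ : ℝ} (hσ : 1 / 2 < σ)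
    (hσ1 : σ < 1) {η : ℝ} (hη : 0 < η) (hησ : η < σ - 1 / 2) :
    ∃ U₀ C : ℝ, 1 ≤ U₀ ∧ 0 ≤ C ∧ ∀ U : ℝ, U₀ ≤ U → ∀ Z : Finset ℂ,
      (∀ ρ ∈ Z, riemannZeta ρ = 0 ∧ σ ≤ ρ.re ∧ U < ρ.im ∧ ρ.im ≤ 2 * U) →
      (∀ ρ ∈ Z, ∀ ρ' ∈ Z, ρ ≠ ρ' → 1 ≤ |ρ.im - ρ'.im|) →
      (Z.card : ℝ) ≤ C * U ^ (3 * (1 - σ) / (2 - σ) + 4 * η) := by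
  classical
  -- constants
  obtain ⟨C₀, hC₀0, hC₀⟩ := exists_isClassOneConst
  obtain ⟨C_d, hCd1, hCd⟩ := Literature.NumberTheory.Sieve.exists_card_divisors_le_mul_rpow' hη
  obtain ⟨C4, hC4⟩ := h4 η hη
  set a : ℝ := 3 / (4 - 2 * σ) with ha
  set κ₀ : ℝ := 3 * (1 - σ) / (2 - σ) with hκ₀
  have ha0 : 0 < a := by rw [ha]; exact div_pos (by norm_num) (by linarith)
  have ha1 : 1 ≤ a := by rw [ha, le_div_iff₀ (by linarith)]; linarith
  have ha32 : a ≤ 3 / 2 := by rw [ha, div_le_iff₀ (by linarith)]; linarith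
  have hκ₀0 : 0 < κ₀ := by rw [hκ₀]; exact div_pos (by linarith) (by linarith)
  obtain ⟨hid1, hid2⟩ := ingham_exponent_identities hσ1
  have haκ : a * (2 - 2 * σ) = κ₀ := by rw [ha, hκ₀]; exact hid1
  have hid2' : 3 - 4 * a * (σ - 1 / 2) = 3 * κ₀ := by rw [ha, hκ₀]; linarith [hid2]
  have hκ₂ : 2 - 2 * σ ≤ κ₀ := by
    rw [hκ₀, le_div_iff₀ (by linarith)]; nlinarith
  -- thresholds (`U₀`)
  have hfl : Tendsto (fun U : ℝ ↦ (⌊U ^ a⌋₊ : ℝ)) atTop atTop :=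
    tendsto_natCast_atTop_atTop.comp (tendsto_nat_floor_atTop.comp (tendsto_rpow_atTop ha0))
  have hev1 : ∀ᶠ U : ℝ in atTop, (4 : ℝ) ≤ (⌊U ^ a⌋₊ : ℝ) := hfl.eventually_ge_atTop 4
  have hev2 : ∀ᶠ U : ℝ in atTop, (256 : ℝ) ≤ (⌊U ^ a⌋₊ : ℝ) ^ (σ - 1 / 2) :=
    ((tendsto_rpow_atTop (by linarith)).comp hfl).eventually_ge_atTop 256
  obtain ⟨U₀', hU₀'⟩ := (hev1.and hev2).exists_forall_of_atTop
  set U₀ : ℝ := max U₀' 32 with hU₀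
  -- the constant
  set C₁ : ℝ := 20736 * C₀ * C_d ^ 2 with hC₁
  set C₄' : ℝ := |C4| * 3 ^ (1 + η) with hC₄'
  set C₂r : ℝ := (((π / 4) ^ 4)⁻¹ * (2 * π / (σ - 1 / 2) ^ 2) *
        (2 / (σ - 1 / 2) * (3 * ((σ - 1 / 2) ^ 2)⁻¹ + 4)) ^ 3 * |C₄'| * 33 ^ 2 *
          2 ^ (4 * (σ - 1 / 2))) ^ (1 / 3 : ℝ) with hC₂r
  set C₃ : ℝ := (C₁ + C₂r) * (1 + 4 / η) ^ 4 with hC₃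
  have hC₁0 : 0 ≤ C₁ := by rw [hC₁]; positivity
  have hC₂r0 : 0 ≤ C₂r := by rw [hC₂r]; positivity
  have hC₃0 : 0 ≤ C₃ := by rw [hC₃]; positivity
  refine ⟨U₀, C₃, le_trans (by norm_num) (le_max_right _ _), hC₃0, ?_⟩
  intro U hU Z hZ hsep
  -- unpack the thresholds
  have hU32 : 32 ≤ U := (le_max_right _ _).trans hU
  have hU1 : 1 ≤ U := by linarith
  have hU0 : 0 < U := by linarith
  obtain ⟨hY4r, hY256⟩ := hU₀' U ((le_max_left _ _).trans hU)
  set X : ℕ := ⌊U⌋₊ with hX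
  set Y : ℕ := ⌊U ^ a⌋₊ with hY
  have hX1 : 1 ≤ X := Nat.le_floor (by simpa using hU1)
  have hXU : (X : ℝ) ≤ U := Nat.floor_le hU0.le
  have hXU2 : U / 2 ≤ X := by
    have := Nat.lt_floor_add_one U; rw [← hX] at this; linarith
  have hY4 : 4 ≤ Y := by exact_mod_cast hY4r
  have hY1 : 1 ≤ Y := by omega
  have hY0 : (0 : ℝ) < Y := by exact_mod_cast (by omega : 0 < Y)
  have hUa1 : 1 ≤ U ^ a := Real.one_le_rpow hU1 ha0.le
  have hYU : (Y : ℝ) ≤ U ^ a := Nat.floor_le (by linarith)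
  have hYU2 : U ^ a / 2 ≤ Y := by
    have := Nat.lt_floor_add_one (U ^ a); rw [← hY] at this; linarith
  set L : ℝ := Real.log U with hL
  have hL0 : 0 ≤ L := Real.log_nonneg hU1
  have hLU : L ≤ U := (Real.log_le_sub_one_of_pos hU0).trans (by linarith)
  have hlogX : Real.log X ≤ L := Real.log_le_log (by exact_mod_cast hX1) hXU
  -- the dyadic parameter `J`
  have hexJ : ∃ J : ℕ, Y ≤ X * 2 ^ J := ⟨Y, by
    calc Y ≤ 2 ^ Y := Nat.lt_two_pow_self.le
      _ ≤ X * 2 ^ Y := Nat.le_mul_of_pos_left _ (by omega)⟩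
  set J : ℕ := Nat.find hexJ with hJdef
  have hJ : Y ≤ X * 2 ^ J := Nat.find_spec hexJ
  have hJmin : ∀ i < J, X * 2 ^ i < Y := fun i hi ↦ by
    have := Nat.find_min hexJ hi
    omega
  have hJle : (J : ℝ) ≤ 3 * (1 + L) := by
    rcases Nat.eq_zero_or_pos J with hJ0 | hJpos
    · rw [hJ0]; simp; linarith
    · have h1 := hJmin (J - 1) (by omega)
      have h2 : 2 ^ (J - 1) < Y := lt_of_le_of_lt (Nat.le_mul_of_pos_left _ (by omega)) h1
      have h3 : ((2 : ℝ)) ^ (J - 1) < Y := by exact_mod_cast h2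
      have hlogY : Real.log Y ≤ a * L := by
        calc Real.log Y ≤ Real.log (U ^ a) := Real.log_le_log hY0 hYU
          _ = a * L := by rw [Real.log_rpow hU0]
      have h4 : ((J : ℝ) - 1) * Real.log 2 < a * L := by
        have := Real.log_lt_log (by positivity) h3
        rw [Real.log_pow, Nat.cast_sub hJpos, Nat.cast_one] at this
        linarith
      have hlog2 : (1 : ℝ) / 2 < Real.log 2 := by
        have := Real.log_two_gt_d9; linarith
      have hJ1 : (1 : ℝ) ≤ J := by exact_mod_cast hJpos
      have h5 : ((J : ℝ) - 1) * (1 / 2) ≤ ((J : ℝ) - 1) * Real.log 2 :=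
        mul_le_mul_of_nonneg_left hlog2.le (by linarith)
      have h6 : a * L ≤ 3 / 2 * L := mul_le_mul_of_nonneg_right ha32 hL0
      linarith
  -- hypotheses of the per-zero dichotomy
  have hres : 2 * Real.sqrt Y * (1 + Real.log X) / U ^ 3 ≤ 1 / 8 := by
    have h1 : Real.sqrt Y ≤ U := by
      rw [Real.sqrt_le_left hU0.le]
      calc (Y : ℝ) ≤ U ^ a := hYU
        _ ≤ U ^ (2 : ℝ) := Real.rpow_le_rpow_of_exponent_le hU1 (by linarith)
        _ = U ^ 2 := by rw [Real.rpow_two]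
    have h2 : 1 + Real.log X ≤ 2 * U := by linarith
    have h3 : 0 ≤ 1 + Real.log X := by linarith [Real.log_nonneg (show (1 : ℝ) ≤ X by exact_mod_cast hX1)]
    rw [div_le_iff₀ (by positivity)]
    calc 2 * Real.sqrt Y * (1 + Real.log X) ≤ 2 * U * (2 * U) :=
          mul_le_mul (mul_le_mul_of_nonneg_left h1 (by norm_num)) h2 h3 (by positivity)
      _ = 4 * U ^ 2 := by ring
      _ ≤ 1 / 8 * U ^ 3 := by nlinarith
  -- the two classes
  set S : ℂ → ℂ := fun ρ ↦ ∑ n ∈ Finset.Ioc X (X * 2 ^ J), coeffB X Y n * (n : ℂ) ^ (-ρ) with hS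
  set Z₁ := Z.filter (fun ρ ↦ 1 / 8 ≤ ‖S ρ‖) with hZ₁
  set Z₂ := Z.filter (fun ρ ↦ ¬ (1 / 8 ≤ ‖S ρ‖)) with hZ₂
  have hcard : (Z.card : ℝ) = Z₁.card + Z₂.card := by
    rw [hZ₁, hZ₂]; exact_mod_cast (Finset.card_filter_add_card_filter_not (fun ρ ↦ 1 / 8 ≤ ‖S ρ‖)).symm
  have hre1 : ∀ ρ ∈ Z, ρ.re < 1 := fun ρ hρ ↦ by
    by_contra h
    exact riemannZeta_ne_zero_of_one_le_re (not_lt.1 h) (hZ ρ hρ).1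
  -- Class I
  have hZ₁card : (Z₁.card : ℝ) ≤ C₁ * (1 + L) ^ 4 * U ^ (κ₀ + 3 * η) := by
    have h := classOne_final hC₀0 hC₀ hCd hη hησ hσ1 ha32 haκ hκ₂ hX1 hY1 hJmin hU1 hXU2 hYU hJle Z₁
      (fun ρ hρ ↦ by
        have hρZ := (Finset.mem_filter.1 hρ).1
        obtain ⟨h0, hb, hg1, hg2⟩ := hZ ρ hρZ
        refine ⟨hb, by linarith [hre1 ρ hρZ], ?_⟩
        rw [abs_of_pos (by linarith)]; exact hg2)
      (fun ρ hρ ρ' hρ' hne ↦ hsep ρ (Finset.mem_filter.1 hρ).1 ρ' (Finset.mem_filter.1 hρ').1 hne)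
      (fun ρ hρ ↦ (Finset.mem_filter.1 hρ).2)
    rw [hC₁]; exact h
  -- Class II
  have hZ₂card : (Z₂.card : ℝ) ≤ C₂r * (1 + L) ^ 4 * U ^ (κ₀ + 3 * η) := by
    have hI4 : ∫ t in (0 : ℝ)..(3 * U), ‖riemannZeta (1 / 2 + t * I)‖ ^ 4 ≤ C₄' * U ^ (1 + η) := by
      refine (hC4 (3 * U) (by linarith)).trans ?_
      rw [Real.mul_rpow (by norm_num) hU0.le, ← mul_assoc, hC₄']
      exact mul_le_mul_of_nonneg_right (mul_le_mul_of_nonneg_right (le_abs_self _) (by positivity))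
        (by positivity)
    have h := classTwo_final hσ hη hid2' hX1 hU1 hXU hY1 hYU2 hI4 Z₂
      (fun ρ hρ ↦ by
        have hρZ := (Finset.mem_filter.1 hρ).1
        obtain ⟨h0, hb, hg1, hg2⟩ := hZ ρ hρZ
        exact ⟨hb, hre1 ρ hρZ, hg1, hg2⟩)
      (fun ρ hρ ρ' hρ' hne ↦ hsep ρ (Finset.mem_filter.1 hρ).1 ρ' (Finset.mem_filter.1 hρ').1 hne)
      (fun ρ hρ ↦ by
        obtain ⟨hρZ, hnot⟩ := Finset.mem_filter.1 hρ
        obtain ⟨h0, hb, hg1, hg2⟩ := hZ ρ hρZ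
        rcases perZero_dichotomy hσ hX1 hY4 hJ hU1 hXU hres hY256 h0 hb hg1 hg2 with hd | hd
        · exact absurd hd hnot
        · exact hd)
    rw [hC₂r]; exact h
  -- total
  have htot : (Z.card : ℝ) ≤ (C₁ + C₂r) * (1 + L) ^ 4 * U ^ (κ₀ + 3 * η) := by
    rw [hcard]; nlinarith [hZ₁card, hZ₂card]
  have hlog4 := one_add_log_pow_four_le hη hU1
  calc (Z.card : ℝ) ≤ (C₁ + C₂r) * (1 + L) ^ 4 * U ^ (κ₀ + 3 * η) := htot
    _ ≤ (C₁ + C₂r) * ((1 + 4 / η) ^ 4 * U ^ η) * U ^ (κ₀ + 3 * η) := by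
        have : 0 ≤ C₁ + C₂r := by positivity
        gcongr
    _ = C₃ * U ^ (κ₀ + 4 * η) := by
        rw [hC₃, show κ₀ + 4 * η = η + (κ₀ + 3 * η) by ring, Real.rpow_add hU0 η (κ₀ + 3 * η)]
        ring

/-- From the eventual well-spaced count to `WellSpacedBound` for all `U ≥ 1` (small `U` by the
trivial count `∑ m(ρ) ≪ U₀ log U₀`, Jensen). [folklore] -/
theorem wellSpacedBound_of_eventually {σ κ : ℝ} (hσ : 1 / 4 ≤ σ) (hκ : 0 ≤ κ) {U₀ C : ℝ} (hU₀ : 1 ≤ U₀)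
    (hC : 0 ≤ C)
    (h : ∀ U : ℝ, U₀ ≤ U → ∀ Z : Finset ℂ,
      (∀ ρ ∈ Z, riemannZeta ρ = 0 ∧ σ ≤ ρ.re ∧ U < ρ.im ∧ ρ.im ≤ 2 * U) →
      (∀ ρ ∈ Z, ∀ ρ' ∈ Z, ρ ≠ ρ' → 1 ≤ |ρ.im - ρ'.im|) → (Z.card : ℝ) ≤ C * U ^ κ) :
    ∃ C' : ℝ, 0 ≤ C' ∧ WellSpacedBound σ κ C' := by
  obtain ⟨CJ, hCJ0, hCJ⟩ := exists_sum_zeroOrder_le_mul_log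
  set K : ℝ := CJ * (2 * U₀ + 2) * Real.log (2 * U₀ + 2) with hK
  have hK0 : 0 ≤ K := by
    rw [hK]; exact mul_nonneg (mul_nonneg hCJ0.le (by linarith)) (Real.log_nonneg (by linarith))
  refine ⟨max C K, le_max_of_le_left hC, fun U hU Z hZ hsep ↦ ?_⟩
  rcases le_or_gt U₀ U with hUU | hUU
  · exact (h U hUU Z hZ hsep).trans (mul_le_mul_of_nonneg_right (le_max_left _ _) (by positivity))
  · -- `U < U₀`: trivial count
    have h1 : (Z.card : ℝ) ≤ ∑ ρ ∈ Z, (riemannZetaZeroOrder ρ : ℝ) := by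
      rw [Finset.card_eq_sum_ones]; push_cast
      refine Finset.sum_le_sum fun ρ hρ ↦ ?_
      obtain ⟨h0, -, hg, -⟩ := hZ ρ hρ
      have hρ1 : ρ ≠ 1 := fun e ↦ by rw [e] at hg; simp at hg; linarith
      have := (riemannZetaZeroOrder_pos_iff hρ1).2 h0
      exact_mod_cast this
    have h2 := hCJ (2 * U₀) (by linarith) Z fun ρ hρ ↦ by
      obtain ⟨h0, hb, hg1, hg2⟩ := hZ ρ hρ
      refine ⟨⟨h0, hσ.trans hb⟩, ?_⟩
      rw [abs_of_pos (by linarith)]; linarith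
    calc (Z.card : ℝ) ≤ K := h1.trans h2
      _ ≤ max C K * U ^ κ := by
          calc K ≤ max C K := le_max_right _ _
            _ = max C K * 1 := (mul_one _).symm
            _ ≤ max C K * U ^ κ :=
                mul_le_mul_of_nonneg_left (Real.one_le_rpow hU hκ) (le_trans hC (le_max_left _ _))

end ZeroDensity

/-- **Ingham's zero-density estimate from the weak fourth moment** (Titchmarsh Thm 9.19(B),
`1/2 ≤ σ ≤ 1`; Ivić 1985, Theorem 11.1 (11.22): `A(σ) ≤ 3/(2-σ)`, printed there for `1/2 ≤ σ ≤ 3/4`,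
the proof below being uniform in `1/2 < σ < 1`): the named fact `Literature.NumberTheory.LFunctions.zeroDensity_ingham`,
`N(σ, T) ≪_ε T^{3(1-σ)/(2-σ)+ε}` for `1/2 ≤ σ ≤ 1`, follows from
`∫_0^T |ζ(1/2+it)|⁴ dt ≪_ε T^{1+ε}` (`Literature.NumberTheory.LFunctions.zetaFourthMomentWeak`). Proof: Montgomery's
zero-detection method with the Riesz kernel (`ZetaZeroDetection`), the discrete mean value theorem
for Class I, Hölder + the fourth moment + the mean square of `M_X` for Class II, `X = T`,
`Y = T^{3/(4-2σ)}`, representatives on unit windows (Jensen) and dyadic summation; the endpoints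
`σ = 1/2` (trivial bound) and `σ = 1` (no zeros) separately.
[cite: Titchmarsh1986, Thm. 9.19(B)]
[cite: Ivic1985, Theorem 11.1 (11.22) and its proof, §11.2–§11.3] -/
theorem zeroDensity_ingham_of_fourthMoment (h4 : zetaFourthMomentWeak) :
    zeroDensity_ingham := by
  intro ε hε σ h₀ h₁
  rcases h₀.eq_or_lt with h | hσ
  · -- `σ = 1/2`: the trivial bound
    subst h
    have h := zeroDensity_trivial ε hε (1 / 2) le_rfl (by norm_num)
    have e : (3 / (2 - (1 / 2 : ℝ)) * (1 - 1 / 2) + ε) = ((1 - (1 / 2 : ℝ))⁻¹ * (1 - 1 / 2) + ε) := by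
      norm_num
    rw [e]; exact h
  rcases h₁.eq_or_lt with h | hσ1
  · -- `σ = 1`: no zeros
    subst h
    refine Asymptotics.IsBigO.of_bound 1 (Eventually.of_forall fun T ↦ ?_)
    rw [zetaZeroCountRe_eq_zero_of_one_le le_rfl]
    simp only [Nat.cast_zero, norm_zero, one_mul]
    exact norm_nonneg _
  · -- `1/2 < σ < 1`
    set η : ℝ := min (ε / 5) ((σ - 1 / 2) / 2) with hη
    have hη0 : 0 < η := by rw [hη]; exact lt_min (by linarith) (by linarith)
    have hηε : 5 * η ≤ ε := by
      have : η ≤ ε / 5 := min_le_left _ _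
      linarith
    have hησ : η < σ - 1 / 2 := by
      have : η ≤ (σ - 1 / 2) / 2 := min_le_right _ _
      linarith
    set κ₀ : ℝ := 3 * (1 - σ) / (2 - σ) with hκ₀
    have hκ₀0 : 0 < κ₀ := by rw [hκ₀]; exact div_pos (by linarith) (by linarith)
    obtain ⟨U₀, C, hU₀, hC0, hws⟩ := ZeroDensity.wellSpaced_of_fourthMoment h4 hσ hσ1 hη0 hησ
    obtain ⟨C', hC'0, hwsb⟩ := ZeroDensity.wellSpacedBound_of_eventually (by linarith) (by positivity)
      hU₀ hC0 hws
    obtain ⟨Cw, hCw0, hCw⟩ := LFunctions.exists_sum_zetaZeroWindow_le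
    have hdy : ∀ U : ℝ, 1 ≤ U → (zetaZeroCountRe σ (2 * U) : ℝ) - zetaZeroCountRe σ U ≤
        (2 * C' * Cw) * U ^ (κ₀ + 4 * η) * Real.log (2 * U + 3) := by
      intro U hU
      have := ZeroDensity.count_dyadic_le (by linarith) hwsb hCw hU
      calc (zetaZeroCountRe σ (2 * U) : ℝ) - zetaZeroCountRe σ U
          ≤ 2 * C' * U ^ (κ₀ + 4 * η) * (Cw * Real.log (2 * U + 3)) := this
        _ = (2 * C' * Cw) * U ^ (κ₀ + 4 * η) * Real.log (2 * U + 3) := by ring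
    have hbig := ZeroDensity.isBigO_of_dyadic (by positivity) (by positivity) hdy hη0
    refine hbig.trans (isBigO_rpow_rpow_atTop_of_le ?_)
    show κ₀ + 4 * η + η ≤ 3 / (2 - σ) * (1 - σ) + ε
    have : 3 / (2 - σ) * (1 - σ) = κ₀ := by rw [hκ₀]; ring
    linarith


/-- **Ingham's zero-density estimate from the approximate functional equation on the critical
line**: `Literature.RH.Bourgain2017_eq43 → Literature.zeroDensity_ingham` (via `zetaFourthMomentWeak_of_eq43`).
[cite: Titchmarsh1986, Thm. 9.19(B)]
[cite: Ivic1985, Theorem 11.1 (11.22) and its proof, §11.2–§11.3] -/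
theorem zeroDensity_ingham_of_eq43 (h : LFunctions.Bourgain2017_eq43) : zeroDensity_ingham :=
  zeroDensity_ingham_of_fourthMoment (zetaFourthMomentWeak_of_eq43 h)

/-- **Discharge of the named fact `Literature.NumberTheory.LFunctions.zeroDensity_ingham`** (Ingham 1940; Titchmarsh Thm 9.19(B),
full range `1/2 ≤ σ ≤ 1`; cf. Ivić Thm 11.1 (11.22), printed there for `1/2 ≤ σ ≤ 3/4` only):
`N(σ, T) ≪_ε T^{3(1-σ)/(2-σ)+ε}` for `1/2 ≤ σ ≤ 1`, unconditionally, by the chain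
`Literature.NumberTheory.LFunctions.Bourgain2017_eq43_holds` (the Hardy–Littlewood approximate functional equation on the
critical line, Titchmarsh Thm 4.13, `ApproxFunctionalEquation.lean`) → `Literature.NumberTheory.LFunctions.zetaFourthMomentWeak`
(`ZetaFourthMomentWeak.lean`, Titchmarsh §7.5) → `zeroDensity_ingham_of_fourthMoment` (this file,
Ivić §11.2–§11.3, an argument uniform in `1/2 < σ < 1`; the endpoints `σ = 1/2, 1` are trivial).
[cite: Titchmarsh1986, Thm. 9.19(B)]
[cite: Ivic1985, Theorem 11.1 (11.22) and its proof, §11.2–§11.3] -/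
theorem zeroDensity_ingham_holds : zeroDensity_ingham :=
  zeroDensity_ingham_of_eq43 LFunctions.Bourgain2017_eq43_holds

end Literature.NumberTheory.LFunctions
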